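/-
Copyright (c) 2026 the pub-hodgecm-mathlib formalisation cell (harness21).  Prover seat hodgecm-mathlib-LH7-p04 (g8): N8-INNER brick (J) «ONE-PLACE JUMPS FROM THE ★ GLOBAL (I₃)»,
PART 2 (the head), dealt by the road owner LH2-plan (g1) 2026-09-02 (16:38:45Z ∕ 16:42:29Z), box LHref-N LH2 #38 (n1)–(n3); consumer (C′) F0P3a-p03.
-/
import Literature.NumberTheory.Rogawski1990.ArchHCOrbitalFamiliesNondeg            -- ★ `exists_jc_archHCSpaceG_orbFamGExt_of_ne_zero` (the global (I₃) at a nondegenerate frame, all noncompact pairs); brings ★ (I₂) `contDiffOn_orbFamGExt_inRegG`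
import Literature.NumberTheory.Rogawski1990.ArchSmoothTensor                        -- ★ p852156 (J) PART 1: `archSmooth_tensor`, `hasCompactSupport_tensor`; brings ★ F5 `chartOrbG_ofReal_re_pos`
import Literature.NumberTheory.Rogawski1990.ArchCartanWallExtensionGDocks           -- ★ `eventually_add_smul_hcNrm_mem_regG`, `add_smul_hcNrm_apply_self ∕ _of_ne`, `hasOneSidedJump_congr`; brings ★ `contDiff_archERhoG`
import Literature.NumberTheory.Rogawski1990.ArchHcJumpWordLetters                   -- ★ `iteratedFDeriv_comp_clm_apply_of_isOpen` (local chain rule through a continuous linear map)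
import Literature.NumberTheory.Rogawski1990.ArchBouazizStableFamilyJumpZero         -- ★ `HasOneSidedJump.const_mul`
import Literature.NumberTheory.Rogawski1990.ArchTransfFamilySymmetries              -- ★ `mem_closure_regG`
import Literature.NumberTheory.Rogawski1990.ArchJumpBricksOfSides                   -- ★ `injective_circleExp_zero_one_two` (the regular background angles `(0, 1, 2)`)
import Literature.NumberTheory.Automorphic.ArchInnerFormChartOrbPlaces              -- ★ G3 `chartOrbG_eq_prod_chartOrbGLoc` (the `G′` chart orbital functional of a tensor is the product of the local ones)
import Literature.NumberTheory.Automorphic.UnitaryFormGroupTestFunctionExtension    -- ★ `isClosedEmbedding_coe_unitaryGroupOfForm`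
import Mathlib.Analysis.Calculus.BumpFunction.FiniteDimension
import HarnessLib

/-!
# One-place jumps from the global (I₃): zero one-sided jumps of the normalised compact reading when the split reading vanishes near the Cayley point

Topic `NumberTheory/Rogawski1990`; namespace `Literature.NumberTheory.Rogawski1990`.  THEOREMS ONLY (no definition, no instance, no notation, no named fact, no `sorry`);
kernel lane `--supports stmt-HodgeConjecture-24833`.  Cell `pub/hodgecm-mathlib` (D-0151), crux H413; HCML «GO 500» road N8-INNER (owner∕dealer LH2-plan (g1)), brick (J)
«ONE-PLACE JUMPS FROM THE ★ GLOBAL (I₃)» for the consumer (C′) F0P3a-p03 (the `dal`-segment assembly at the corner of a quasi-split place).  HONEST LABEL: count-neutral;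
HC_CM is proved only modulo the 7 printed citations (2 remaining: hLiu418 = stmt-HodgeConjecture-24832, h413 = stmt-HodgeConjecture-24833) until rung 0 closes.

THE STATEMENT (head `hasOneSidedJump_onePlace_zero_of_split_vanishes`).  Frame `diag β` hermitian and nondegenerate (`hherm`, `hβ`; (C′) instantiates the quasi-split `β₀`),
an admissible compact-chart label `S′ ∌ w` at a split-chart place `w`, a NONCOMPACT pair `(i, j)` at `w` (`slotSign L β w i ≠ slotSign L β w j`; at a `β₀`-place both `(0,2)` and
`(1,2)`), a one-place test function `f : U(β)_w → ℂ` (restriction of an ambient `C^∞` `fa` on `M₃(ℂ)`, compact support — E1's token), a wall point `p_w` of the pair (`p_w i = p_w j`,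
third eigenvalue distinct).  HYPOTHESIS (n1): the one-place SPLIT reading `chartOrbGLoc L β w (insert w S′) ν_w f` vanishes on a punctured neighbourhood `𝓝[{x_w ≠ 0}]` of the Cayley
coordinates `(0, p_w k, (p_w i + p_w j)∕2)`.  CONCLUSION: every adapted-word jet (letters `Fin 3` AT `w`: `(w, i)` normal, `(w, j)` tangential, `(w, k)` the third angle — the
`w`-components of ★ `hcAdaptedVec`) of the NORMALISED one-place compact reading `eρ_w · R′_w · chartOrbGLoc L β w S′ ν_w f` (the `w ∉ S′` factors of ★ `archERhoG`, ★ `archRG`,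
VERBATIM) has one-sided jump `0` across the wall along `p_w + ν (e_i − e_j)`.

THE PROOF = THE TENSOR TRICK (census `F0/P3c/LH7/LH7-p04/g8/j/CENSUS-N8-brickJ-onePlaceJumps.v1.LH7p04g8.md` §1).  (a) Extend `p_w` to a global semiregular `p` by REGULAR coordinates at
the other places and tensor `f` with one-place bumps `b_v` (Mathlib `ContDiffBump` on `M₃(ℂ)` centred at the torus blocks `γ_v(p_v)`, restricted along the closed embedding
`U(β)_v ↪ M₃(ℂ)`): `a′ = f ⊗ ⊗_{v ≠ w} b_v ∈ C_c^∞(G′_∞)` by ★ `archSmooth_tensor`.  (b) The ★ global (I₃) (`exists_jc_archHCSpaceG_orbFamGExt_of_ne_zero`, clause ★ `ArchHcJump`)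
gives the jump of every adapted `w`-word jet of `eρ · orbFamGExt ν′ a′ S′` along `p + ν • hcNrm w i j` as `jc′ · hcCayScalar · (Cayley jet of eρ · orbFamGExt ν′ a′ (insert w S′) at
hcCayPt w i j p)`.  (c) Under (n1) the member `orbFamGExt … (insert w S′)` VANISHES on a neighbourhood of the Cayley point (★ G3 factorisation on `RegG`, the ★ `hcExtendG` extension
through `extendFrom` on the real wall `x_w = 0`, ★ `mem_closure_regG`), so the Cayley jet and hence the jump are `0`.  (d) OFF the wall (`ν ≠ 0` small, ★ `eventually_add_smul_hcNrm_mem_regG`;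
no extension theory is used on the compact side) `eρ · orbFamGExt … S′ = eρ · R′ · chartOrbG = Π_v H_v(c_v)` (★ G3; ★ `archERhoG`, ★ `archRG` are products over the places), and an
adapted `w`-word only differentiates the `w`-slice (★ `iteratedFDeriv_comp_clm_apply_of_isOpen` through `Pi.single w`, Mathlib `iteratedFDeriv_comp_add_left`): the global jet is
`(Π_{v ≠ w} H_v(p_v)) ·` the one-place jet, the prefactor a NON-ZERO constant (★ F5 `chartOrbG_ofReal_re_pos` on the tensor of bumps at the regular background point, ★
`archRG_ne_zero_of_mem_regG`); divide (★ `HasOneSidedJump.const_mul`).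

* §1 `archERhoG_mul_archRG_eq_prod` — the place-by-place product form of `eρ · R′` (the regular background angles `(0, 1, 2)` are ★ `injective_circleExp_zero_one_two`).
* §2 `onePlaceNormaliser_ne_zero` — (n3): the verbatim normaliser is `≠ 0` off the three walls.
* §3 **`hasOneSidedJump_onePlace_zero_of_split_vanishes`** — the head.

## References
* [Shelstad1979] D. Shelstad, *Characters and inner forms of a quasi-split group over `ℝ`*, Compositio Math. 39 (1979), §4 Lemma 4.3 p. 25, Prop. 4.5 p. 26 (the jump relations).
* [Bouaziz1994IntegralesOrbitales] A. Bouaziz, *Intégrales orbitales sur les algèbres de Lie réductives*, Invent. Math. 115 (1994), §3.2 (I₃) p. 580.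
* [Varadarajan1977] V. S. Varadarajan, *Harmonic Analysis on Real Reductive Groups*, LNM 576 (1977), Part I §1.12 (Harish-Chandra's `'F_f`).
* [Rogawski1990] J. D. Rogawski, *Automorphic Representations of Unitary Groups in Three Variables*, Ann. of Math. Stud. 123 (1990), §8.2 p. 122 (orbital integrals over the places).
* [BorelJacquet1979] A. Borel, H. Jacquet, *Automorphic forms and automorphic representations*, PSPM 33.1 (1979), §4.1 (tensors over the places).
-/

set_option autoImplicit false

noncomputable section

open MeasureTheory MeasureTheory.Measure NumberField NumberField.InfinitePlace Matrix Complex Set Filter Topology Function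
open scoped MatrixGroups Matrix Real Classical ENNReal NNReal ContDiff
open Literature.NumberTheory.Automorphic Literature.NumberTheory.Automorphic.UnitaryGroup Literature.NumberTheory.Automorphic.ArchCartan
open Literature.NumberTheory.Automorphic.Shelstad1979.StableOrbitalIntegrals
open Literature.NumberTheory.GaloisRepresentations

namespace Literature.NumberTheory.Rogawski1990

/-! ## §1 `eρ · R′` place by place -/

section Background

variable {W : Type*} [Fintype W] [DecidableEq W]

/-- **`eρ_{S′} · R′_{S′}` IS A PRODUCT OVER THE PLACES of the one-place normalisers**: at a compact-chart place (`v ∉ S′`) `e^{i(θ₀−θ₂)} · Π_{i<j}(1 − e^{i(θ_j − θ_i)})`, at a split-chart place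
(`v ∈ S′`) `|e^{x} − e^{−x}| · |e^{x+iθ} − e^{iφ}| · |e^{−x+iθ} − e^{iφ}|` (★ `archERhoG`, ★ `archRG` verbatim). [cite: Shelstad1979, §4 p. 22, p. 24] -/
theorem archERhoG_mul_archRG_eq_prod (S' : Finset W) (c : W → Fin 3 → ℝ) :
    archERhoG S' c * archRG S' c = ∏ v, if v ∈ S' then
        (((|Real.exp (c v 0) - Real.exp (-c v 0)| *
          ‖Complex.exp (c v 0 + c v 2 * I) - Complex.exp (c v 1 * I)‖ * ‖Complex.exp (-c v 0 + c v 2 * I) - Complex.exp (c v 1 * I)‖ : ℝ) : ℂ))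
      else (Circle.exp (c v 0 - c v 2) : ℂ) *
        ((1 - (Circle.exp (c v 1 - c v 0) : ℂ)) * (1 - (Circle.exp (c v 2 - c v 0) : ℂ)) * (1 - (Circle.exp (c v 2 - c v 1) : ℂ))) := by
  unfold archERhoG archRG
  rw [← Finset.prod_mul_distrib]
  refine Finset.prod_congr rfl fun v _ => ?_
  split_ifs <;> ring

end Background

/-! ## §2 (n3) The one-place normaliser is non-zero off the walls -/

section Normaliser

/-- **(n3) THE ONE-PLACE NORMALISER `eρ_w · R′_w` IS NON-ZERO OFF THE THREE WALLS**: if the three eigenvalue angles have pairwise distinct `e^{iθ_l}` then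
`e^{i(θ₀−θ₂)} (1 − e^{i(θ₁−θ₀)})(1 − e^{i(θ₂−θ₀)})(1 − e^{i(θ₂−θ₁)}) ≠ 0`; its ONLY zero near a semiregular point of the wall `(i, j)` is the simple factor `1 − e^{i(θ_j − θ_i)}` (resp. its
`(j, i)` mirror), which (C′) divides out by Hadamard. [cite: Shelstad1979, §4 p. 22] -/
theorem onePlaceNormaliser_ne_zero {cw : Fin 3 → ℝ} (h : Function.Injective fun l : Fin 3 => Circle.exp (cw l)) :
    (Circle.exp (cw 0 - cw 2) : ℂ) *
        ((1 - (Circle.exp (cw 1 - cw 0) : ℂ)) * (1 - (Circle.exp (cw 2 - cw 0) : ℂ)) * (1 - (Circle.exp (cw 2 - cw 1) : ℂ))) ≠ 0 := by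
  have h01 : Circle.exp (cw 0) ≠ Circle.exp (cw 1) := fun e => absurd (h e) (by decide)
  have h02 : Circle.exp (cw 0) ≠ Circle.exp (cw 2) := fun e => absurd (h e) (by decide)
  have h12 : Circle.exp (cw 1) ≠ Circle.exp (cw 2) := fun e => absurd (h e) (by decide)
  exact mul_ne_zero (Circle.coe_ne_zero _) (mul_ne_zero (mul_ne_zero ((one_sub_coe_circleExp_sub_ne_zero_iff _ _).2 h01)
    ((one_sub_coe_circleExp_sub_ne_zero_iff _ _).2 h02)) ((one_sub_coe_circleExp_sub_ne_zero_iff _ _).2 h12))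

end Normaliser

/-! ## §3 The head -/

section Head

variable (L : Type) [Field L] [NumberField L] [IsCMField L] (β : Fin 3 → L)
  [∀ v : {w : InfinitePlace L // IsComplex w}, MeasurableSpace ↥(archLocal L 3 (Matrix.diagonal β) v)]
  [∀ v : {w : InfinitePlace L // IsComplex w}, BorelSpace ↥(archLocal L 3 (Matrix.diagonal β) v)]
  [MeasurableSpace ↥(arch (↥(maximalRealSubfield L)) L (IsCMField.complexConj L) 3 (Matrix.diagonal β))]
  [BorelSpace ↥(arch (↥(maximalRealSubfield L)) L (IsCMField.complexConj L) 3 (Matrix.diagonal β))]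
  (ν'w : ∀ v : {w : InfinitePlace L // IsComplex w}, Measure ↥(archLocal L 3 (Matrix.diagonal β) v)) [∀ v, (ν'w v).IsHaarMeasure] [∀ v, (ν'w v).IsMulRightInvariant]
  (ν' : Measure ↥(arch (↥(maximalRealSubfield L)) L (IsCMField.complexConj L) 3 (Matrix.diagonal β))) [ν'.IsHaarMeasure] [ν'.IsMulRightInvariant]
  (hν : ν' = (Measure.pi ν'w).map (archPiEquivCM 3 L (Matrix.diagonal β)).symm)

-- the scoped `ℓ^∞`-operator norm on `M₃(ℂ)` (★ one-place convention for the ambient `fa`, token for token E1∕(KN))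
open scoped Matrix.Norms.Operator

include hν in
/-- **(J) ONE-PLACE JUMPS FROM THE ★ GLOBAL (I₃): ZERO ONE-SIDED JUMPS OF THE NORMALISED COMPACT READING WHEN THE SPLIT READING VANISHES NEAR THE CAYLEY POINT.**  At a split-chart place
`w ∉ S′` of the nondegenerate hermitian frame `diag β` (product-measure convention `ν′ = e⁻¹_* ⊗_v ν′_v` of ★ G3), for a noncompact pair `(i, j)` at `w`, a one-place test function `f` on
`U(β)_w` (ambient `C^∞`, compact support) and a wall point `p_w` (`p_w i = p_w j`, `e^{iθ_k} ≠ e^{iθ_i}`): IF the one-place split reading `chartOrbGLoc L β w (insert w S′) ν′_w f` vanishes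
on a punctured neighbourhood `𝓝[{x ≠ 0}]` of the Cayley coordinates `(0, p_w k, (p_w i + p_w j)∕2)` (n1), THEN for every word `l : Fin n → Fin 3` of adapted letters at `w` the jet
`Dⁿ_{l}(eρ_w R′_w · chartOrbGLoc L β w S′ ν′_w f)` along the normal ray `p_w + ν(e_i − e_j)` has one-sided jump `0` at `ν = 0`.  Tensor-trick corollary of ★
`exists_jc_archHCSpaceG_orbFamGExt_of_ne_zero` (docblock (a)–(d)). [cite: Shelstad1979, Lemma 4.3 (p. 25), Prop. 4.5 (p. 26)] [cite: Bouaziz1994IntegralesOrbitales, §3.2 (I₃) p. 580]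
[cite: Varadarajan1977, I §1.12] [cite: Rogawski1990, §8.2 p. 122] [cite: BorelJacquet1979, §4.1] -/
theorem hasOneSidedJump_onePlace_zero_of_split_vanishes
    (hherm : ((Matrix.diagonal β).map (cmConjRingHom L)).transpose = Matrix.diagonal β) (hβ : ∀ i, β i ≠ 0)
    (S' : Finset {w : InfinitePlace L // IsComplex w}) (hS' : ∀ v, v ∈ S' → v ∈ splitChartPlaces L β)
    (w : {w : InfinitePlace L // IsComplex w}) (hw : w ∉ S') (hwsp : w ∈ splitChartPlaces L β)
    (i j : Fin 3) (hij : i ≠ j) (hs : slotSign L β w i ≠ slotSign L β w j)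
    (f : ↥(archLocal L 3 (Matrix.diagonal β) w) → ℂ) (fa : Matrix (Fin 3) (Fin 3) ℂ → ℂ) (hfa : ContDiff ℝ ∞ fa)
    (hf : ∀ g, f g = fa ((g : GL (Fin 3) ℂ) : Matrix (Fin 3) (Fin 3) ℂ)) (hfs : HasCompactSupport f)
    (pw : Fin 3 → ℝ) (hpw : pw i = pw j) (hpk : Circle.exp (pw (hcThird i j)) ≠ Circle.exp (pw i))
    (hvan : ∀ᶠ cw in 𝓝[{cw : Fin 3 → ℝ | cw 0 ≠ 0}] (![0, pw (hcThird i j), (pw i + pw j) / 2] : Fin 3 → ℝ),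
      chartOrbGLoc L β w (insert w S') (ν'w w) f cw = 0)
    (n : ℕ) (l : Fin n → Fin 3) :
    HasOneSidedJump
      (fun ν : ℝ => iteratedFDeriv ℝ n
        (fun cw : Fin 3 → ℝ => (Circle.exp (cw 0 - cw 2) : ℂ) *
          ((1 - (Circle.exp (cw 1 - cw 0) : ℂ)) * (1 - (Circle.exp (cw 2 - cw 0) : ℂ)) * (1 - (Circle.exp (cw 2 - cw 1) : ℂ))) *
            chartOrbGLoc L β w S' (ν'w w) f cw)
        (pw + ν • ((Pi.single i 1 : Fin 3 → ℝ) - Pi.single j 1)) (fun r => hcAdaptedVec w i j (w, l r) w))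
      0 := by
  have hreal : ∀ (v : {w : InfinitePlace L // IsComplex w}) (i : Fin 3), (v.1.embedding (β i)).im = 0 :=
    im_embedding_diagonal_eq_zero L 3 β (complexConj_apply_eq_of_diagonal_frame hherm)
  have hS'i : ∀ v, v ∈ insert w S' → v ∈ splitChartPlaces L β := fun v hv => by
    rcases Finset.mem_insert.1 hv with rfl | hv
    · exact hwsp
    · exact hS' v hv
  haveI : FiniteDimensional ℝ (Matrix (Fin 3) (Fin 3) ℂ) := FiniteDimensional.complexToReal _
  /- (a) the regular background point and the global semiregular wall point -/
  obtain ⟨preg, hpreg_def⟩ : ∃ preg : {w : InfinitePlace L // IsComplex w} → Fin 3 → ℝ, preg = fun v => if v ∈ S' then ![1, 0, 0] else ![0, 1, 2] := ⟨_, rfl⟩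
  have hpreg_of_not : ∀ v, v ∉ S' → preg v = ![0, 1, 2] := fun v hv => by rw [hpreg_def]; exact if_neg hv
  have hpreg_of_mem : ∀ v, v ∈ S' → preg v = ![1, 0, 0] := fun v hv => by rw [hpreg_def]; exact if_pos hv
  have hpreg : preg ∈ RegG S' := by
    refine ⟨fun v hv => ?_, fun v hv => ?_⟩
    · rw [hpreg_of_not v hv]; exact injective_circleExp_zero_one_two
    · rw [hpreg_of_mem v hv]; exact one_ne_zero
  obtain ⟨p, hp_def⟩ : ∃ p : {w : InfinitePlace L // IsComplex w} → Fin 3 → ℝ, p = Function.update preg w pw := ⟨_, rfl⟩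
  have hp_w : p w = pw := by rw [hp_def, Function.update_self]
  have hp_ne : ∀ v, v ≠ w → p v = preg v := fun v hv => by rw [hp_def, Function.update_of_ne hv]
  have hp : HcSemireg S' w i j p := by
    refine ⟨by rw [hp_w]; exact hpw, by rw [hp_w]; exact hpk, fun v hv hvw => ?_, fun v hv => ?_⟩
    · rw [hp_ne v hvw, hpreg_of_not v hv]; exact injective_circleExp_zero_one_two
    · rw [hp_ne v (fun h => hw (h ▸ hv)), hpreg_of_mem v hv]; exact one_ne_zero
  /- (a) the one-place bumps at the torus blocks of the background point, restricted along `U(β)_v ↪ M₃(ℂ)` -/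
  have hdet : ∀ v : {w : InfinitePlace L // IsComplex w}, ((Matrix.diagonal β).map v.1.embedding).det ≠ 0 := fun v => by
    rw [Matrix.diagonal_map (map_zero _), Matrix.det_diagonal]
    exact Finset.prod_ne_zero_iff.2 fun i _ => (map_ne_zero _).2 (hβ i)
  have hce : ∀ v : {w : InfinitePlace L // IsComplex w},
      IsClosedEmbedding (fun g : ↥(archLocal L 3 (Matrix.diagonal β) v) => ((g : GL (Fin 3) ℂ) : Matrix (Fin 3) (Fin 3) ℂ)) := fun v =>
    isClosedEmbedding_coe_unitaryGroupOfForm ((Matrix.diagonal β).map v.1.embedding) (hdet v)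
  obtain ⟨bump, hbump⟩ : ∃ bump : ∀ v : {w : InfinitePlace L // IsComplex w}, ContDiffBump (((gprimeBlockAt L β v S' (preg v) : ↥(archLocal L 3 (Matrix.diagonal β) v)) : GL (Fin 3) ℂ) : Matrix (Fin 3) (Fin 3) ℂ),
      ∀ v, (bump v).rIn = 1 := ⟨fun v => ⟨1, 2, one_pos, one_lt_two⟩, fun v => rfl⟩
  obtain ⟨Fc, hFc⟩ : ∃ Fc : ∀ v : {w : InfinitePlace L // IsComplex w}, ↥(archLocal L 3 (Matrix.diagonal β) v) → ℂ,
      Fc = fun v (g : ↥(archLocal L 3 (Matrix.diagonal β) v)) => (((bump v) ((g : GL (Fin 3) ℂ) : Matrix (Fin 3) (Fin 3) ℂ) : ℝ) : ℂ) := ⟨_, rfl⟩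
  have hFcs : ∀ v, HasCompactSupport (Fc v) := fun v => by
    rw [hFc]
    exact ((bump v).hasCompactSupport.comp_left (g := fun t : ℝ => (t : ℂ)) Complex.ofReal_zero).comp_isClosedEmbedding (hce v)
  have hFcc : ∀ v, Continuous (Fc v) := fun v => by
    rw [hFc]
    exact continuous_ofReal.comp ((bump v).continuous.comp (hce v).continuous)
  -- the tensor `f ⊗ ⊗_{v ≠ w} b_v` and its ambient data
  obtain ⟨F, hF⟩ : ∃ F : ∀ v : {w : InfinitePlace L // IsComplex w}, ↥(archLocal L 3 (Matrix.diagonal β) v) → ℂ, F = Function.update Fc w f := ⟨_, rfl⟩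
  have hFw : F w = f := by rw [hF, Function.update_self]
  have hFne : ∀ v, v ≠ w → F v = Fc v := fun v hv => by rw [hF, Function.update_of_ne hv]
  obtain ⟨a', ha'_def⟩ : ∃ a' : ↥(arch (↥(maximalRealSubfield L)) L (IsCMField.complexConj L) 3 (Matrix.diagonal β)) → ℂ,
      a' = fun k => ∏ v, F v (archPiEquivCM 3 L (Matrix.diagonal β) k v) := ⟨_, rfl⟩
  have ha' : ArchSmooth L 3 (Matrix.diagonal β) a' := by
    rw [ha'_def]
    refine archSmooth_tensor L β F (Function.update (fun v X => (((bump v) X : ℝ) : ℂ)) w fa) (fun v => ?_) (fun v g => ?_) (fun v => ?_)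
    · by_cases hv : v = w
      · subst hv; rw [Function.update_self]; exact hfa
      · rw [Function.update_of_ne hv]; exact ofRealCLM.contDiff.comp (bump v).contDiff
    · by_cases hv : v = w
      · subst hv; rw [hFw, Function.update_self]; exact hf g
      · rw [hFne v hv, Function.update_of_ne hv, hFc]
    · by_cases hv : v = w
      · subst hv; rw [hFw]; exact hfs
      · rw [hFne v hv]; exact hFcs v
  /- (b) the global (I₃) for `a′` at the pair `(w, i, j)` -/
  obtain ⟨jc', hjc⟩ := exists_jc_archHCSpaceG_orbFamGExt_of_ne_zero L β ν' hherm hβ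
  have hJ := (hjc a' ha').2.2.2.2 S' w hw i j hij hs p hp n (fun r => (w, l r))
  /- (c) the split member vanishes near the Cayley point, so the Cayley jet is `0` -/
  have hq_w : hcCayPt w i j p w = ![0, pw (hcThird i j), (pw i + pw j) / 2] := by
    rw [hcCayPt, Function.update_self, hp_w]
  have hvan' : ∀ᶠ c in 𝓝 (hcCayPt w i j p), c w 0 ≠ 0 → chartOrbGLoc L β w (insert w S') (ν'w w) f (c w) = 0 := by
    have h1 : ∀ᶠ cw in 𝓝 (hcCayPt w i j p w), cw ∈ {cw : Fin 3 → ℝ | cw 0 ≠ 0} → chartOrbGLoc L β w (insert w S') (ν'w w) f cw = 0 := by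
      rw [hq_w]; exact eventually_nhdsWithin_iff.1 hvan
    exact ((continuous_apply w).tendsto (hcCayPt w i j p)).eventually h1
  obtain ⟨U, hUvan, hUo, hqU⟩ := eventually_nhds_iff.1 hvan'
  have hzero : ∀ c ∈ U, orbFamGExt L β ν' a' (insert w S') c = 0 := by
    -- on `RegG` the member is `R′ · Π_v chartOrbGLoc_v` with the `w`-factor `0`
    have hreg : ∀ c ∈ U, c ∈ RegG (insert w S') → orbFamG L β ν' a' (insert w S') c = 0 := fun c hcU hc => by
      rw [orbFamG_apply L β ν' a' hS'i, chartOrbG_eq_prod_chartOrbGLoc L β (insert w S') ν'w ν' hν hβ hS'i a' F (fun g => by rw [ha'_def]) c,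
        Finset.prod_eq_zero (Finset.mem_univ w) (by rw [hFw]; exact hUvan c hcU (hc.2 w (Finset.mem_insert_self w S'))), mul_zero]
    intro c hcU
    by_cases hc : c ∈ RegG (insert w S')
    · rw [orbFamGExt_of_mem_regG L β ν' a' (insert w S') hc]; exact hreg c hcU hc
    by_cases hc' : c ∈ InRegG (slotSign L β) (insert w S')
    · rw [orbFamGExt_of_mem_inRegG_of_not_mem_regG L β ν' a' (insert w S') hc' hc]
      refine extendFrom_eq (mem_closure_regG (insert w S') c) (tendsto_const_nhds.congr' ?_)
      filter_upwards [inter_mem_nhdsWithin (RegG (insert w S')) (hUo.mem_nhds hcU)] with c' hc'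
      exact (hreg c' hc'.2 hc'.1).symm
    · exact orbFamGExt_of_not_mem_inRegG L β ν' a' (insert w S') hc'
  have hCay : hcTwistedDeriv (insert w S') n (fun r => hcCayVec w i j (w, l r)) (orbFamGExt L β ν' a' (insert w S')) (hcCayPt w i j p) = 0 := by
    have hev : (fun c => archERhoG (insert w S') c * orbFamGExt L β ν' a' (insert w S') c) =ᶠ[𝓝 (hcCayPt w i j p)]
        fun _ => (0 : ℂ) :=
      Filter.eventually_of_mem (hUo.mem_nhds hqU) fun c hc => by simp only [hzero c hc, mul_zero]
    unfold hcTwistedDeriv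
    rw [(hev.iteratedFDeriv ℝ n).self_of_nhds, iteratedFDeriv_fun_zero]
    rfl
  have hJ0 : HasOneSidedJump
      (fun ν : ℝ => hcTwistedDeriv S' n (fun r => hcAdaptedVec w i j (w, l r)) (orbFamGExt L β ν' a' S') (p + ν • hcNrm w i j)) 0 := by
    refine HasOneSidedJump.jump_congr hJ ?_
    rw [hCay, mul_zero]
  /- (d) OFF the wall: the global twisted member is the product of the one-place normalised readings -/
  -- the one-place normalised readings and the global product form on `RegG S′`
  obtain ⟨H, hH⟩ : ∃ H : {w : InfinitePlace L // IsComplex w} → (Fin 3 → ℝ) → ℂ, H = fun v x =>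
      (if v ∈ S' then
          (((|Real.exp (x 0) - Real.exp (-x 0)| *
            ‖Complex.exp (x 0 + x 2 * I) - Complex.exp (x 1 * I)‖ * ‖Complex.exp (-x 0 + x 2 * I) - Complex.exp (x 1 * I)‖ : ℝ) : ℂ))
        else (Circle.exp (x 0 - x 2) : ℂ) * ((1 - (Circle.exp (x 1 - x 0) : ℂ)) * (1 - (Circle.exp (x 2 - x 0) : ℂ)) * (1 - (Circle.exp (x 2 - x 1) : ℂ)))) *
        chartOrbGLoc L β v S' (ν'w v) (F v) x := ⟨_, rfl⟩
  have hprod : ∀ c ∈ RegG S', archERhoG S' c * orbFamGExt L β ν' a' S' c = ∏ v, H v (c v) := fun c hc => by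
    rw [orbFamGExt_of_mem_regG_of_admissible L β ν' a' S' hS' hc, ← mul_assoc, archERhoG_mul_archRG_eq_prod,
      chartOrbG_eq_prod_chartOrbGLoc L β S' ν'w ν' hν hβ hS' a' F (fun g => by rw [ha'_def]) c, ← Finset.prod_mul_distrib, hH]
  have hHw : (fun cw : Fin 3 → ℝ => (Circle.exp (cw 0 - cw 2) : ℂ) *
      ((1 - (Circle.exp (cw 1 - cw 0) : ℂ)) * (1 - (Circle.exp (cw 2 - cw 0) : ℂ)) * (1 - (Circle.exp (cw 2 - cw 1) : ℂ))) *
        chartOrbGLoc L β w S' (ν'w w) f cw) = H w := by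
    funext cw; simp only [hH, hw, if_false, hFw]
  rw [hHw]
  -- the constant prefactor `Π_{v ≠ w} H_v(p_v)` is non-zero: positivity of the tensor of bumps at the regular background point
  have hg : (∏ v ∈ Finset.univ.erase w, H v (p v)) ≠ 0 := by
    -- the tensor of ALL the bumps
    obtain ⟨freal, hfreal⟩ : ∃ freal : ↥(arch (↥(maximalRealSubfield L)) L (IsCMField.complexConj L) 3 (Matrix.diagonal β)) → ℝ,
        freal = fun k => ∏ v, (bump v) (((archPiEquivCM 3 L (Matrix.diagonal β) k v : ↥(archLocal L 3 (Matrix.diagonal β) v)) : GL (Fin 3) ℂ) : Matrix (Fin 3) (Fin 3) ℂ) := ⟨_, rfl⟩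
    have hcpx : (fun k => ((freal k : ℝ) : ℂ)) = fun k => ∏ v, Fc v (archPiEquivCM 3 L (Matrix.diagonal β) k v) := by
      funext k; rw [hfreal, hFc, Complex.ofReal_prod]
    have hfc : Continuous freal := by
      rw [hfreal]
      exact continuous_finsetProd _ fun v _ => (bump v).continuous.comp ((hce v).continuous.comp ((continuous_apply v).comp (archPiEquivCM 3 L (Matrix.diagonal β)).continuous))
    have hfs' : HasCompactSupport freal := by
      have h := hasCompactSupport_tensor L β Fc hFcs
      rw [← hcpx] at h
      exact (hasCompactSupport_comp_left (g := fun t : ℝ => (t : ℂ)) (f := freal) (fun {x} => Complex.ofReal_eq_zero)).1 h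
    have h0 : ∀ k, 0 ≤ freal k := fun k => by rw [hfreal]; exact Finset.prod_nonneg fun v _ => (bump v).nonneg
    have hpos : 0 < freal (gprimeTorus L β S' preg) := by
      rw [hfreal]
      refine Finset.prod_pos fun v _ => ?_
      rw [archPiEquivCM_gprimeTorus, gprimeBlock_eq_gprimeBlockAt, (bump v).one_of_mem_closedBall (Metric.mem_closedBall_self (bump v).rIn_pos.le)]
      exact one_pos
    have hre := chartOrbG_ofReal_re_pos L β ν' hβ hS' hfc hfs' h0 hpreg hpos
    rw [hcpx, chartOrbG_eq_prod_chartOrbGLoc L β S' ν'w ν' hν hβ hS' _ Fc (fun g => rfl) preg] at hre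
    have hne : (∏ v, chartOrbGLoc L β v S' (ν'w v) (Fc v) (preg v)) ≠ 0 := fun h => by rw [h, Complex.zero_re] at hre; exact lt_irrefl _ hre
    have hfac : ∀ v, v ≠ w → H v (p v) ≠ 0 := fun v hv => by
      simp only [hH, hFne v hv, hp_ne v hv]
      refine mul_ne_zero ?_ ((Finset.prod_ne_zero_iff.1 hne) v (Finset.mem_univ v))
      -- the normaliser at the regular background coordinates: a factor of `eρ · R′ ≠ 0`
      have hall := Finset.prod_ne_zero_iff.1 (by
        rw [← archERhoG_mul_archRG_eq_prod]
        exact mul_ne_zero (Finset.prod_ne_zero_iff.2 fun v _ => by split_ifs; exacts [one_ne_zero, Circle.coe_ne_zero _])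
          (archRG_ne_zero_of_mem_regG hpreg)) v (Finset.mem_univ v)
      exact hall
    exact Finset.prod_ne_zero_iff.2 fun v hv => hfac v (Finset.ne_of_mem_erase hv)
  -- the slice through `Pi.single w`: the global point and directions
  obtain ⟨A, hA⟩ : ∃ A : (Fin 3 → ℝ) →L[ℝ] ({w : InfinitePlace L // IsComplex w} → Fin 3 → ℝ), A = ContinuousLinearMap.single ℝ (fun _ => Fin 3 → ℝ) w := ⟨_, rfl⟩
  have hA_apply : ∀ x, A x = Pi.single w x := fun x => by rw [hA]; rfl
  have hupd : ∀ x : Fin 3 → ℝ, Function.update p w x = Function.update p w 0 + A x := fun x => by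
    funext v
    by_cases hv : v = w
    · subst hv; rw [Pi.add_apply, hA_apply, Function.update_self, Function.update_self, Pi.single_eq_same, zero_add]
    · rw [Pi.add_apply, hA_apply, Function.update_of_ne hv, Function.update_of_ne hv, Pi.single_eq_of_ne hv, add_zero]
  have hray : ∀ ν : ℝ, p + ν • hcNrm w i j = Function.update p w (pw + ν • ((Pi.single i 1 : Fin 3 → ℝ) - Pi.single j 1)) := fun ν => by
    funext v
    by_cases hv : v = w
    · subst hv
      rw [Function.update_self]
      funext m
      rw [add_smul_hcNrm_apply_self, hp_w, Pi.add_apply, Pi.smul_apply, Pi.sub_apply, Pi.single_apply, Pi.single_apply, smul_eq_mul]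
    · rw [add_smul_hcNrm_apply_of_ne p ν hv, Function.update_of_ne hv]
  have hdir : ∀ m : Fin 3, hcAdaptedVec w i j (w, m) = A (hcAdaptedVec w i j (w, m) w) := fun m => by
    rw [hA_apply]
    unfold hcAdaptedVec
    simp only [if_true]
    split_ifs <;> rw [Pi.single_eq_same]
  -- smoothness of the twisted member on `RegG S′` and of its slice
  have hsm : ContDiffOn ℝ ∞ (fun c => archERhoG S' c * orbFamGExt L β ν' a' S' c) (RegG S') :=
    (contDiff_archERhoG S').contDiffOn.mul ((contDiffOn_orbFamGExt_inRegG L β ν' S' hβ hreal hS' ha').mono (regG_subset_inRegG _ S'))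
  have hsm' : ContDiffOn ℝ ∞ (fun z => archERhoG S' (Function.update p w 0 + z) * orbFamGExt L β ν' a' S' (Function.update p w 0 + z))
      ((fun z => Function.update p w 0 + z) ⁻¹' RegG S') :=
    hsm.comp (contDiff_const.add contDiff_id).contDiffOn fun z hz => hz
  have hopen : IsOpen ((fun z : {w : InfinitePlace L // IsComplex w} → Fin 3 → ℝ => Function.update p w 0 + z) ⁻¹' RegG S') :=
    (isOpen_regG S').preimage (continuous_const.add continuous_id)
  -- the jet identity off the wall
  have hjet : ∀ ν : ℝ, p + ν • hcNrm w i j ∈ RegG S' →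
      hcTwistedDeriv S' n (fun r => hcAdaptedVec w i j (w, l r)) (orbFamGExt L β ν' a' S') (p + ν • hcNrm w i j) =
        (∏ v ∈ Finset.univ.erase w, H v (p v)) *
          iteratedFDeriv ℝ n (H w) (pw + ν • ((Pi.single i 1 : Fin 3 → ℝ) - Pi.single j 1)) (fun r => hcAdaptedVec w i j (w, l r) w) := by
    intro ν hν0
    set x : Fin 3 → ℝ := pw + ν • ((Pi.single i 1 : Fin 3 → ℝ) - Pi.single j 1) with hx
    have hxreg : Function.update p w 0 + A x ∈ RegG S' := by rw [← hupd, ← hray]; exact hν0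
    -- (1) move to the slice
    have h1a : iteratedFDeriv ℝ n (fun z => archERhoG S' (Function.update p w 0 + z) * orbFamGExt L β ν' a' S' (Function.update p w 0 + z)) (A x) =
        iteratedFDeriv ℝ n (fun c => archERhoG S' c * orbFamGExt L β ν' a' S' c) (Function.update p w 0 + A x) :=
      iteratedFDeriv_comp_add_left (f := fun c => archERhoG S' c * orbFamGExt L β ν' a' S' c) n (Function.update p w 0) (A x)
    have h1 : hcTwistedDeriv S' n (fun r => hcAdaptedVec w i j (w, l r)) (orbFamGExt L β ν' a' S') (p + ν • hcNrm w i j) =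
        iteratedFDeriv ℝ n ((fun z => archERhoG S' (Function.update p w 0 + z) * orbFamGExt L β ν' a' S' (Function.update p w 0 + z)) ∘ A) x
          (fun r => hcAdaptedVec w i j (w, l r) w) := by
      unfold hcTwistedDeriv
      rw [iteratedFDeriv_comp_clm_apply_of_isOpen A hopen hsm' hxreg, h1a, ← hupd, ← hray ν]
      congr 1
      funext r
      exact hdir (l r)
    -- (2) on the slice the member is the constant times the one-place reading, near `x`
    have hO : IsOpen {y : Fin 3 → ℝ | Function.update p w 0 + A y ∈ RegG S'} := (isOpen_regG S').preimage (continuous_const.add A.continuous)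
    have hslice : ((fun z => archERhoG S' (Function.update p w 0 + z) * orbFamGExt L β ν' a' S' (Function.update p w 0 + z)) ∘ A) =ᶠ[𝓝 x]
        fun y => (∏ v ∈ Finset.univ.erase w, H v (p v)) • H w y := by
      filter_upwards [hO.mem_nhds hxreg] with y hy
      rw [smul_eq_mul, Function.comp_apply, hprod _ hy, ← hupd, ← Finset.mul_prod_erase Finset.univ (fun v => H v (Function.update p w y v)) (Finset.mem_univ w),
        Function.update_self, mul_comm]
      congr 1
      exact Finset.prod_congr rfl fun v hv => by rw [Function.update_of_ne (Finset.ne_of_mem_erase hv)]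
    -- (3) the one-place reading is smooth at `x` (it is a constant multiple of the smooth slice there)
    have hHx : ContDiffAt ℝ n (H w) x := by
      have hsl : ContDiffAt ℝ n ((fun z => archERhoG S' (Function.update p w 0 + z) * orbFamGExt L β ν' a' S' (Function.update p w 0 + z)) ∘ A) x :=
        ((hsm'.of_le (by exact_mod_cast le_top)).contDiffAt (hopen.mem_nhds hxreg)).comp x A.contDiff.contDiffAt
      have hsl' : ContDiffAt ℝ n (fun y => (∏ v ∈ Finset.univ.erase w, H v (p v)) • H w y) x := hsl.congr_of_eventuallyEq hslice.symm
      refine (hsl'.const_smul (∏ v ∈ Finset.univ.erase w, H v (p v))⁻¹).congr_of_eventuallyEq (Filter.Eventually.of_forall fun y => ?_)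
      show H w y = (∏ v ∈ Finset.univ.erase w, H v (p v))⁻¹ • (∏ v ∈ Finset.univ.erase w, H v (p v)) • H w y
      rw [smul_smul, inv_mul_cancel₀ hg, one_smul]
    rw [h1, (hslice.iteratedFDeriv ℝ n).self_of_nhds, iteratedFDeriv_const_smul_apply' hHx, _root_.smul_apply, smul_eq_mul]
  /- (d) divide out the prefactor -/
  have hev : (fun ν : ℝ => hcTwistedDeriv S' n (fun r => hcAdaptedVec w i j (w, l r)) (orbFamGExt L β ν' a' S') (p + ν • hcNrm w i j)) =ᶠ[𝓝[≠] (0 : ℝ)]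
      fun ν => (∏ v ∈ Finset.univ.erase w, H v (p v)) *
        iteratedFDeriv ℝ n (H w) (pw + ν • ((Pi.single i 1 : Fin 3 → ℝ) - Pi.single j 1)) (fun r => hcAdaptedVec w i j (w, l r) w) := by
    filter_upwards [eventually_add_smul_hcNrm_mem_regG hw hij hp] with ν hν using hjet ν hν
  have h2 := HasOneSidedJump.const_mul (∏ v ∈ Finset.univ.erase w, H v (p v))⁻¹ ((hasOneSidedJump_congr hev 0).1 hJ0)
  rw [mul_zero] at h2
  refine (hasOneSidedJump_congr (Filter.Eventually.of_forall fun ν => ?_) 0).1 h2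
  exact inv_mul_cancel_left₀ hg _

end Head

end Literature.NumberTheory.Rogawski1990
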